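import Literature.MathematicalPhysics.QuantumLattice.HubbardHalfFilledGroundStateTorus
import Literature.MathematicalPhysics.QuantumLattice.HubbardSpinFlipSymmetry
import HarnessLib

/-!
# Spin-reflection positivity of the half-filled Hubbard ground state (Lieb's Gram block)

Lieb, PRL 62 (1989) 1201, proof of Theorem 2: on a connected bipartite lattice `Λ = A ⊔ B` with
`|A| = |B|`, `t ≠ 0`, `U > 0`, the ground state of the Hubbard Hamiltonian at half filling
`N = |Λ|` is unique and, in the two-species coordinates `ψ = Φ(W) = Σ W_{αβ} ψ↑^α ⊗ ψ̃↓^β`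
(up configurations `α`, down **holes** `β`, after the sublattice-staggered particle–hole
transformation of the down spins), its coefficient matrix `W` is positive definite
(`LiebTwo.exists_posDef_groundState`, `LiebHalfFilled.exists_unit_groundState`).

This file formalises that structural fact in OPERATOR form — the "spin-reflection positivity"
of the ground state (Tian, J. Stat. Phys. 116 (2004) 629: ground-state expectations of products
`O_↑ Õ_↓` form a Gram matrix), which is what a ground-state relaxation can use as a positive
semidefinite block valid for THE ground state (Kull–Schuch–Dive–Navascués, PRX 14 (2024) 021008
§5.3: symmetry/positivity constraints of the unique ground state may be imposed on the relaxation):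

* `Φ` intertwines every up-spin ladder operator with LEFT multiplication by the spinless ladder
  matrix (`creation_orb_zero_mulVec_toFock`, `annihilation_orb_zero_mulVec_toFock`) and every
  down-spin ladder operator, up to the sublattice sign `ε_x = memSign A x` and the up-parity, with
  RIGHT multiplication (`creation_orb_one_mulVec_toFock`, `annihilation_orb_one_mulVec_toFock`);
  hence an up word `u(l) = Π_{(i,j) ∈ l} c†_{i↑} c_{j↑}` acts as `W ↦ X_l W` and a
  Shiba-transformed down word `d̃(l) = Π_{(k,l') ∈ l} ε_k ε_{l'} c_{k↓} c†_{l'↓}` as `W ↦ W X_lᵀ`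
  (`upWord_mulVec_toFock`, `shibaDownWord_mulVec_toFock`), with the same real spinless word matrix
  `X_l` (`wordMatrix`); only the products `ε_x ε_y` matter (`hε`).
* Consequently `⟨Φ(W), u(a) d̃(b) Φ(W)⟩ = Tr (Wᴴ X_a W X_bᵀ)`
  (`star_toFock_dotProduct_upWord_mul_shibaDownWord_mulVec`) and for `W ⪰ 0` the matrix
  `[⟨u(w a) d̃(w b)⟩]_{ab}` is a Gram matrix, hence positive semidefinite
  (`posSemidef_hsInner_sandwich`, `exists_posDef_coefficient_of_groundState`,
  `liebGram_posSemidef`); the same holds with the roles of the spins exchanged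
  (`liebGram_posSemidef_flip`, by the spin-flip symmetry `relabel_spinSwap_hamiltonian`). Paired
  with a dual matrix `G ⪰ 0` this gives the LIEB FORMS `liebForm ε G w = Σ_ab G_ab u(w a) d̃(w b)`,
  `liebFormFlip`, of nonnegative ground-state expectation (`liebForm_expect_nonneg`, `…Flip…`).
* The even square torus `(ℤ/Lℤ)²` at half filling, `ε = torusSign = (-1)^{x₁+x₂}`:
  `hubbardTorus_liebGram_posSemidef(_flip)`, `hubbardTorus_liebForm(_Flip)_expect_nonneg`, stated
  for every `L²`-particle `ψ` with `H ψ = E₀(L²) ψ` (by uniqueness, THE ground state).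

The block is valid ONLY at half filling on a balanced connected bipartite graph with `U > 0`
(a property of the unique ground state, not of every state), exactly like the `S² = 0` singlet
rows; the certificate rows consuming it (cell `pub-hubbard`, block kinds `liebgram` /
`liebgram_flip`) are stated problem-side, in
`Summits/HubbardSuperconductivity/HubbardLadder/LiebGramRows.lean`.

References: E. H. Lieb, *Two theorems on the Hubbard model*, PRL 62 (1989) 1201, Theorem 2 and its
proof [cite: LiebPRL1989, proof of Theorem 2]; G.-S. Tian, *Lieb's spin-reflection-positivity
method and its applications to strongly correlated electron systems*, J. Stat. Phys. 116 (2004)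
629 (review of the method and of the ground-state correlation inequalities it yields; bib key
`Tian2004`, cite-only, acq-01365); Kull–Schuch–Dive–Navascués, PRX 14 (2024) 021008 §5.3
[cite: KullEtAl2024, §5.3].
-/

noncomputable section

namespace Literature.MathematicalPhysics.QuantumLattice

open Matrix Finset
open scoped ComplexOrder MatrixOrder

namespace LiebTwo

/-! ### Ladder operators in Lieb's two-species coordinates -/

section LadderActions

variable {Λ : Type*} [LinearOrder Λ] [Fintype Λ]

/-- `(c†_i ψ)(s) = [i ∈ s] σ_i(s ∖ i) ψ(s ∖ i)`. [folklore] -/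
private theorem creation_mulVec_apply' {ι : Type*} [LinearOrder ι] [Fintype ι] (i : ι)
    (ψ : Fock ι) (s : Finset ι) :
    (creation i *ᵥ ψ) s = if i ∈ s then jwSign i (s.erase i) * ψ (s.erase i) else 0 := by
  simp only [mulVec, dotProduct, creation_apply]
  by_cases hi : i ∈ s
  · rw [if_pos hi, Finset.sum_eq_single (s.erase i)]
    · rw [if_pos ⟨Finset.notMem_erase i s, (Finset.insert_erase hi).symm⟩]
    · intro t _ ht
      rw [if_neg, zero_mul]
      rintro ⟨hit, rfl⟩
      exact ht (by rw [Finset.erase_insert hit])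
    · intro h; exact absurd (Finset.mem_univ _) h
  · rw [if_neg hi]
    refine Finset.sum_eq_zero fun t _ => ?_
    rw [if_neg, zero_mul]
    rintro ⟨hit, rfl⟩
    exact hi (Finset.mem_insert_self i t)

/-- `(c_x M)_{αβ} = [x ∉ α] σ_x(α) M_{α ∪ x, β}`. [folklore] -/
private theorem annihilation_left_mul_apply (x : Λ) (M : Matrix (Finset Λ) (Finset Λ) ℂ) (α β : Finset Λ) :
    (annihilation x * M) α β = if x ∉ α then jwSign x α * M (insert x α) β else 0 := by
  rw [Matrix.mul_apply]
  by_cases hx : x ∉ α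
  · rw [if_pos hx, Finset.sum_eq_single (insert x α)]
    · rw [annihilation_apply, if_pos ⟨hx, rfl⟩]
    · intro α' _ hne
      rw [annihilation_apply, if_neg (fun h => hne h.2), zero_mul]
    · intro h; exact absurd (Finset.mem_univ _) h
  · rw [if_neg hx]
    exact Finset.sum_eq_zero fun α' _ => by
      rw [annihilation_apply, if_neg (fun h => hx h.1), zero_mul]

/-- `(M c†_y)_{αβ} = [y ∉ β] M_{α, β ∪ y} σ_y(β)`. [folklore] -/
private theorem mul_creation_apply (M : Matrix (Finset Λ) (Finset Λ) ℂ) (y : Λ) (α β : Finset Λ) :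
    (M * creation y) α β = if y ∉ β then M α (insert y β) * jwSign y β else 0 := by
  rw [Matrix.mul_apply]
  by_cases hy : y ∉ β
  · rw [if_pos hy, Finset.sum_eq_single (insert y β)]
    · rw [creation_apply, if_pos ⟨hy, rfl⟩]
    · intro β' _ hne
      rw [creation_apply, if_neg (fun h => hne h.2), mul_zero]
    · intro h; exact absurd (Finset.mem_univ _) h
  · rw [if_neg hy]
    exact Finset.sum_eq_zero fun β' _ => by
      rw [creation_apply, if_neg (fun h => hy h.1), mul_zero]

/-- `(M c_x)_{αβ} = [x ∈ β] M_{α, β ∖ x} σ_x(β ∖ x)`. [folklore] -/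
private theorem mul_annihilation_apply (M : Matrix (Finset Λ) (Finset Λ) ℂ) (x : Λ) (α β : Finset Λ) :
    (M * annihilation x) α β = if x ∈ β then M α (β.erase x) * jwSign x (β.erase x) else 0 := by
  rw [Matrix.mul_apply]
  by_cases hx : x ∈ β
  · rw [if_pos hx, Finset.sum_eq_single (β.erase x)]
    · rw [annihilation_apply, if_pos ⟨Finset.notMem_erase x β, (Finset.insert_erase hx).symm⟩]
    · intro β' _ hne
      rw [annihilation_apply, if_neg, mul_zero]
      rintro ⟨hxβ', h⟩
      exact hne (by rw [h, Finset.erase_insert hxβ'])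
    · intro h; exact absurd (Finset.mem_univ _) h
  · rw [if_neg hx]
    refine Finset.sum_eq_zero fun β' _ => ?_
    rw [annihilation_apply, if_neg, mul_zero]
    rintro ⟨-, h⟩
    exact hx (by rw [h]; exact Finset.mem_insert_self x β')

variable (Λ) in
/-- The up-parity `(-1)^{N↑}` as a diagonal matrix on up configurations. [folklore] -/
def upParity : Matrix (Finset Λ) (Finset Λ) ℂ := diagonal fun α => (-1) ^ α.card

/-- `(-1)^{N↑} (-1)^{N↑} = 1`. [folklore] -/
private theorem upParity_mul_upParity : upParity Λ * upParity Λ = 1 := by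
  rw [upParity, diagonal_mul_diagonal, ← diagonal_one]
  congr 1; funext α
  rw [← mul_pow]; norm_num

/-- Entries of `(-1)^{N↑} M`. [folklore] -/
private theorem upParity_mul_apply (M : Matrix (Finset Λ) (Finset Λ) ℂ) (α β : Finset Λ) :
    (upParity Λ * M) α β = (-1) ^ α.card * M α β := by
  rw [upParity, diagonal_mul]

/-- **Up creation in Lieb's coordinates**: `c†_{y↑} Φ(M) = Φ(c†_y M)`. [cite: LiebPRL1989, proof of Theorem 2] -/
theorem creation_orb_zero_mulVec_toFock (A : Finset Λ) (y : Λ) (M : Matrix (Finset Λ) (Finset Λ) ℂ) :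
    creation (orb y 0) *ᵥ toFock A M = toFock A (creation y * M) := by
  funext s
  rw [← pairSet_upPart_downPart s]
  generalize upPart s = α; generalize downPart s = γ
  rw [creation_mulVec_apply', toFock_pairSet, LiebThm1.creation_mul_apply, pairSet_erase_zero,
    toFock_pairSet, jwSign_orb_zero]
  by_cases hy : y ∈ α
  · rw [if_pos ((orb_zero_mem_pairSet α γ y).2 hy), if_pos hy]
    have hps : pairSign α γ = jwSign y γ * pairSign (α.erase y) γ := by
      conv_lhs => rw [← Finset.insert_erase hy]
      rw [pairSign_insert_left (Finset.notMem_erase y α)]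
    rw [hps]; ring
  · rw [if_neg (fun h => hy ((orb_zero_mem_pairSet α γ y).1 h)), if_neg hy, mul_zero]

/-- **Up annihilation in Lieb's coordinates**: `c_{x↑} Φ(M) = Φ(c_x M)`. [cite: LiebPRL1989, proof of Theorem 2] -/
theorem annihilation_orb_zero_mulVec_toFock (A : Finset Λ) (x : Λ) (M : Matrix (Finset Λ) (Finset Λ) ℂ) :
    annihilation (orb x 0) *ᵥ toFock A M = toFock A (annihilation x * M) := by
  funext s
  rw [← pairSet_upPart_downPart s]
  generalize upPart s = α; generalize downPart s = γ
  rw [PosSemidefTrace.annihilation_mulVec_apply, toFock_pairSet, annihilation_left_mul_apply,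
    pairSet_insert_zero, toFock_pairSet, jwSign_orb_zero]
  by_cases hx : x ∉ α
  · rw [if_pos (fun h => hx ((orb_zero_mem_pairSet α γ x).1 h)), if_pos hx, pairSign_insert_left hx]
    have h1 := jwSign_mul_self x γ
    linear_combination (jwSign x α * pairSign α γ * kappaSign A γᶜ * M (insert x α) γᶜ) * h1
  · rw [if_neg (fun h => h ((orb_zero_mem_pairSet α γ x).2 (not_not.1 hx))), if_neg hx, mul_zero]

/-- `σ_y(univ) = σ_y(γ) σ_y(γᶜ)`. [folklore] -/
private theorem jwSign_univ_eq (y : Λ) (γ : Finset Λ) :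
    jwSign y (univ : Finset Λ) = jwSign y γ * jwSign y γᶜ := by
  rw [← Finset.union_compl γ, jwSign_union disjoint_compl_right]

/-- **Down creation in Lieb's coordinates**: `c†_{y↓} Φ(M) = ε_y Φ((-1)^{N↑} M c†_y)` with
`ε_y = memSign A y` the sublattice sign (a down electron created = a hole annihilated). [cite: LiebPRL1989, proof of Theorem 2] -/
theorem creation_orb_one_mulVec_toFock (A : Finset Λ) (y : Λ) (M : Matrix (Finset Λ) (Finset Λ) ℂ) :
    creation (orb y 1) *ᵥ toFock A M = memSign A y • toFock A (upParity Λ * M * creation y) := by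
  funext s
  rw [← pairSet_upPart_downPart s]
  generalize upPart s = α; generalize downPart s = γ
  rw [Pi.smul_apply, smul_eq_mul, creation_mulVec_apply', pairSet_erase_one, toFock_pairSet,
    toFock_pairSet, Matrix.mul_assoc, upParity_mul_apply, mul_creation_apply, jwSign_orb_one_eq,
    Finset.compl_erase]
  by_cases hy : y ∈ γ
  · have hyc : y ∉ γᶜ := fun h => (Finset.mem_compl.1 h) hy
    rw [if_pos ((orb_one_mem_pairSet α γ y).2 hy), if_pos hyc]
    have h1 : pairSign α γ = gtSign y α * pairSign α (γ.erase y) := by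
      conv_lhs => rw [← Finset.insert_erase hy]
      rw [LiebThm1.pairSign_insert_right α (Finset.notMem_erase y γ)]
    have h2 : kappaSign A (insert y γᶜ) = memSign A y * jwSign y univ * kappaSign A γᶜ :=
      kappaSign_insert A hyc
    have h3 := jwSign_mul_memSign_mul_gtSign y α
    rw [h1, h2, ← h3, jwSign_univ_eq y γ, jwSign_erase_of_not_lt (lt_irrefl y)]
    have h6 := gtSign_mul_self y α
    have h7 := jwSign_mul_self y γ
    linear_combination (jwSign y α * memSign α y * pairSign α (γ.erase y) * memSign A y *
        jwSign y γᶜ * kappaSign A γᶜ * M α (insert y γᶜ)) * h7 -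
      (jwSign y α * memSign α y * pairSign α (γ.erase y) * memSign A y *
        jwSign y γᶜ * kappaSign A γᶜ * M α (insert y γᶜ)) * h6
  · rw [if_neg (fun h => hy ((orb_one_mem_pairSet α γ y).1 h)),
      if_neg (not_not.2 (Finset.mem_compl.2 hy)), mul_zero, mul_zero, mul_zero]

/-- **Down annihilation in Lieb's coordinates**: `c_{x↓} Φ(M) = ε_x Φ((-1)^{N↑} M c_x)`
(a down electron annihilated = a hole created). [cite: LiebPRL1989, proof of Theorem 2] -/
theorem annihilation_orb_one_mulVec_toFock (A : Finset Λ) (x : Λ) (M : Matrix (Finset Λ) (Finset Λ) ℂ) :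
    annihilation (orb x 1) *ᵥ toFock A M = memSign A x • toFock A (upParity Λ * M * annihilation x) := by
  funext s
  rw [← pairSet_upPart_downPart s]
  generalize upPart s = α; generalize downPart s = γ
  rw [Pi.smul_apply, smul_eq_mul, PosSemidefTrace.annihilation_mulVec_apply, pairSet_insert_one,
    toFock_pairSet, toFock_pairSet, Matrix.mul_assoc, upParity_mul_apply, mul_annihilation_apply,
    jwSign_orb_one_eq, Finset.compl_insert]
  by_cases hx : x ∉ γ
  · have hxc : x ∈ γᶜ := Finset.mem_compl.2 hx
    rw [if_pos (fun h => hx ((orb_one_mem_pairSet α γ x).1 h)), if_pos hxc,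
      LiebThm1.pairSign_insert_right α hx]
    have h2 : kappaSign A γᶜ = memSign A x * jwSign x univ * kappaSign A (γᶜ.erase x) := by
      conv_lhs => rw [← Finset.insert_erase hxc]
      rw [kappaSign_insert A (Finset.notMem_erase x γᶜ)]
    have h3 := jwSign_mul_memSign_mul_gtSign x α
    rw [h2, ← h3, jwSign_univ_eq x γ, jwSign_erase_of_not_lt (lt_irrefl x)]
    have h8 := memSign_mul_self A x
    have h9 := jwSign_mul_self x γᶜ
    linear_combination (-(pairSign α γ * jwSign x γ * kappaSign A (γᶜ.erase x) * jwSign x α *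
        memSign α x * gtSign x α * M α (γᶜ.erase x) * (jwSign x γᶜ * jwSign x γᶜ))) * h8 -
      (pairSign α γ * jwSign x γ * kappaSign A (γᶜ.erase x) * jwSign x α *
        memSign α x * gtSign x α * M α (γᶜ.erase x)) * h9
  · rw [if_neg (fun h => h ((orb_one_mem_pairSet α γ x).2 (not_not.1 hx))),
      if_neg (fun h => (Finset.mem_compl.1 h) (not_not.1 hx)), mul_zero, mul_zero, mul_zero]

/-- **The Shiba-transformed down hopping in Lieb's coordinates**:
`ε_x ε_y c_{x↓} c†_{y↓} Φ(M) = Φ(M c†_y c_x)` — right multiplication, no sign left. [cite: LiebPRL1989, proof of Theorem 2] -/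
theorem shibaHop_mulVec_toFock (A : Finset Λ) (x y : Λ) (M : Matrix (Finset Λ) (Finset Λ) ℂ) :
    ((memSign A x * memSign A y) • (annihilation (orb x 1) * creation (orb y 1))) *ᵥ toFock A M =
      toFock A (M * (creation y * annihilation x)) := by
  rw [Matrix.smul_mulVec, ← mulVec_mulVec, creation_orb_one_mulVec_toFock, mulVec_smul,
    annihilation_orb_one_mulVec_toFock, smul_smul, smul_smul, ← toFock_smul]
  congr 1
  have hs : memSign A x * memSign A y * memSign A y * memSign A x = 1 := by
    have h1 := memSign_mul_self A x
    have h2 := memSign_mul_self A y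
    linear_combination (memSign A x * memSign A x) * h2 + h1
  rw [hs, one_smul]
  simp only [Matrix.mul_assoc]
  rw [← Matrix.mul_assoc (upParity Λ) (upParity Λ), upParity_mul_upParity, Matrix.one_mul]

/-! ### Words -/

/-- The spinless word matrix `X(l) = Π_{(i,j) ∈ l} c†_i c_j` of a list of site pairs. [folklore] -/
def wordMatrix (l : List (Λ × Λ)) : Matrix (Finset Λ) (Finset Λ) ℂ :=
  (l.map fun p => creation p.1 * annihilation p.2).prod

/-- The up word `u(l) = Π_{(i,j) ∈ l} c†_{i↑} c_{j↑}`. [folklore] -/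
def upWord (l : List (Λ × Λ)) : Matrix (Finset (Orb Λ)) (Finset (Orb Λ)) ℂ :=
  (l.map fun p => creation (orb p.1 0) * annihilation (orb p.2 0)).prod

/-- The down word `d(l) = Π_{(i,j) ∈ l} c†_{i↓} c_{j↓}`. [folklore] -/
def downWord (l : List (Λ × Λ)) : Matrix (Finset (Orb Λ)) (Finset (Orb Λ)) ℂ :=
  (l.map fun p => creation (orb p.1 1) * annihilation (orb p.2 1)).prod

/-- The Shiba (staggered particle–hole) transformed down word
`d̃(l) = Π_{(k,l) ∈ l} ε_k ε_l c_{k↓} c†_{l↓}` for a sign function `ε`. [cite: LiebPRL1989, proof of Theorem 2] -/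
def shibaDownWord (ε : Λ → ℂ) (l : List (Λ × Λ)) : Matrix (Finset (Orb Λ)) (Finset (Orb Λ)) ℂ :=
  (l.map fun p => (ε p.1 * ε p.2) • (annihilation (orb p.1 1) * creation (orb p.2 1))).prod

/-- The Shiba transformed up word `ũ(l) = Π ε_k ε_l c_{k↑} c†_{l↑}`. [cite: LiebPRL1989, proof of Theorem 2] -/
def shibaUpWord (ε : Λ → ℂ) (l : List (Λ × Λ)) : Matrix (Finset (Orb Λ)) (Finset (Orb Λ)) ℂ :=
  (l.map fun p => (ε p.1 * ε p.2) • (annihilation (orb p.1 0) * creation (orb p.2 0))).prod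

/-- `(c†_k c_l)ᵀ = c†_l c_k` (the hopping matrices are real). [folklore] -/
private theorem creation_mul_annihilation_transpose (k l : Λ) :
    (creation k * annihilation l)ᵀ = creation l * annihilation k := by
  have h : creation k * annihilation l = (creation l * annihilation k)ᴴ := by
    unfold creation
    rw [conjTranspose_mul, conjTranspose_conjTranspose]
  rw [h]; ext s u
  rw [transpose_apply, conjTranspose_apply, LiebThm1.star_creation_mul_annihilation_apply]

/-- The word matrices are real. [folklore] -/
private theorem star_wordMatrix_apply (l : List (Λ × Λ)) (s u : Finset Λ) :
    star (wordMatrix l s u) = wordMatrix l s u := by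
  induction l generalizing s u with
  | nil =>
    rw [wordMatrix, List.map_nil, List.prod_nil, Matrix.one_apply]
    split_ifs <;> simp
  | cons p l ih =>
    have h : wordMatrix (p :: l) = (creation p.1 * annihilation p.2) * wordMatrix l := by
      rw [wordMatrix, List.map_cons, List.prod_cons]; rfl
    rw [h, Matrix.mul_apply, star_sum]
    exact Finset.sum_congr rfl fun c _ => by
      rw [star_mul', LiebThm1.star_creation_mul_annihilation_apply, ih]

/-- `X(l)ᴴ = X(l)ᵀ`. [folklore] -/
private theorem wordMatrix_conjTranspose (l : List (Λ × Λ)) : (wordMatrix l)ᴴ = (wordMatrix l)ᵀ := by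
  ext s u; rw [conjTranspose_apply, transpose_apply, star_wordMatrix_apply]

/-- **Up words act by left multiplication**: `u(l) Φ(M) = Φ(X(l) M)`. [cite: LiebPRL1989, proof of Theorem 2] -/
theorem upWord_mulVec_toFock (A : Finset Λ) (M : Matrix (Finset Λ) (Finset Λ) ℂ) (l : List (Λ × Λ)) :
    upWord l *ᵥ toFock A M = toFock A (wordMatrix l * M) := by
  induction l with
  | nil => simp [upWord, wordMatrix]
  | cons p l ih =>
    have hu : upWord (p :: l) = (creation (orb p.1 0) * annihilation (orb p.2 0)) * upWord l := by
      rw [upWord, List.map_cons, List.prod_cons]; rfl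
    have hw : wordMatrix (p :: l) = (creation p.1 * annihilation p.2) * wordMatrix l := by
      rw [wordMatrix, List.map_cons, List.prod_cons]; rfl
    rw [hu, hw, ← mulVec_mulVec, ih, ← mulVec_mulVec, annihilation_orb_zero_mulVec_toFock,
      creation_orb_zero_mulVec_toFock]
    simp only [Matrix.mul_assoc]

/-- **Shiba down words act by right multiplication with the transpose**:
`d̃(l) Φ(M) = Φ(M X(l)ᵀ)` whenever `ε_x ε_y = memSign A x · memSign A y` (i.e. `ε = ± memSign A`).
[cite: LiebPRL1989, proof of Theorem 2] -/
theorem shibaDownWord_mulVec_toFock (A : Finset Λ) {ε : Λ → ℂ}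
    (hε : ∀ x y, ε x * ε y = memSign A x * memSign A y)
    (M : Matrix (Finset Λ) (Finset Λ) ℂ) (l : List (Λ × Λ)) :
    shibaDownWord ε l *ᵥ toFock A M = toFock A (M * (wordMatrix l)ᵀ) := by
  induction l with
  | nil => simp [shibaDownWord, wordMatrix]
  | cons p l ih =>
    have hd : shibaDownWord ε (p :: l) =
        ((ε p.1 * ε p.2) • (annihilation (orb p.1 1) * creation (orb p.2 1))) * shibaDownWord ε l := by
      rw [shibaDownWord, List.map_cons, List.prod_cons]; rfl
    have hw : wordMatrix (p :: l) = (creation p.1 * annihilation p.2) * wordMatrix l := by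
      rw [wordMatrix, List.map_cons, List.prod_cons]; rfl
    rw [hd, hw, ← mulVec_mulVec, ih, hε, shibaHop_mulVec_toFock, transpose_mul,
      creation_mul_annihilation_transpose, Matrix.mul_assoc]

/-- **The mixed correlator in Lieb's coordinates**:
`⟨Φ(M), u(a) d̃(b) Φ(M)⟩ = Tr (Mᴴ X_a M X_bᵀ)`. [cite: LiebPRL1989, proof of Theorem 2] -/
theorem star_toFock_dotProduct_upWord_mul_shibaDownWord_mulVec (A : Finset Λ) {ε : Λ → ℂ}
    (hε : ∀ x y, ε x * ε y = memSign A x * memSign A y)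
    (M : Matrix (Finset Λ) (Finset Λ) ℂ) (a b : List (Λ × Λ)) :
    star (toFock A M) ⬝ᵥ ((upWord a * shibaDownWord ε b) *ᵥ toFock A M) =
      hsInner M (wordMatrix a * M * (wordMatrix b)ᵀ) := by
  rw [← mulVec_mulVec, shibaDownWord_mulVec_toFock A hε, upWord_mulVec_toFock,
    star_toFock_dotProduct_toFock, Matrix.mul_assoc]

end LadderActions

/-! ### Gram matrices of sandwiched words -/

section Gram

variable {μ : Type*} [Fintype μ] [DecidableEq μ]

/-- For `M ⪰ 0` and matrices `X_b` with `X_bᴴ = X_bᵀ` (real entries), the matrix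
`[Tr (Mᴴ X_a M X_bᵀ)]_{ab} = [Tr (F_a F_bᴴ)]_{ab}`, `F_a = B X_a Bᴴ`, `M = Bᴴ B`, is a Gram matrix,
hence positive semidefinite. [folklore] -/
private theorem posSemidef_hsInner_sandwich {M : Matrix μ μ ℂ} (hM : M.PosSemidef) {κ : Type*} [Fintype κ]
    (X : κ → Matrix μ μ ℂ) (hX : ∀ b, (X b)ᴴ = (X b)ᵀ) :
    (Matrix.of fun a b : κ => hsInner M (X a * M * (X b)ᵀ)).PosSemidef := by
  obtain ⟨B, hB⟩ := CStarAlgebra.nonneg_iff_eq_star_mul_self.mp hM.nonneg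
  rw [Matrix.star_eq_conjTranspose] at hB
  have hMh : Mᴴ = M := hM.1
  have hentry : ∀ a b, hsInner M (X a * M * (X b)ᵀ) =
      ((Matrix.of fun (a : κ) (ij : μ × μ) => (B * X a * Bᴴ) ij.1 ij.2) *
        (Matrix.of fun (a : κ) (ij : μ × μ) => (B * X a * Bᴴ) ij.1 ij.2)ᴴ) a b := by
    intro a b
    calc hsInner M (X a * M * (X b)ᵀ)
        = (M * (X a * M * (X b)ᴴ)).trace := by rw [hsInner, hMh, ← hX b]
      _ = (Bᴴ * (B * X a * Bᴴ * B * (X b)ᴴ)).trace := by rw [hB]; simp only [Matrix.mul_assoc]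
      _ = ((B * X a * Bᴴ * B * (X b)ᴴ) * Bᴴ).trace := Matrix.trace_mul_comm _ _
      _ = ((B * X a * Bᴴ) * (B * X b * Bᴴ)ᴴ).trace := by
          simp only [conjTranspose_mul, conjTranspose_conjTranspose, Matrix.mul_assoc]
      _ = ∑ i, ∑ j, (B * X a * Bᴴ) i j * star ((B * X b * Bᴴ) i j) := by
          simp only [Matrix.trace, Matrix.diag_apply, Matrix.mul_apply, conjTranspose_apply]
      _ = _ := by
          rw [Matrix.mul_apply, Fintype.sum_prod_type]
          simp only [Matrix.of_apply, conjTranspose_apply]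
  have hmat : (Matrix.of fun a b : κ => hsInner M (X a * M * (X b)ᵀ)) =
      (Matrix.of fun (a : κ) (ij : μ × μ) => (B * X a * Bᴴ) ij.1 ij.2) *
        (Matrix.of fun (a : κ) (ij : μ × μ) => (B * X a * Bᴴ) ij.1 ij.2)ᴴ := by
    ext a b; rw [Matrix.of_apply, hentry]
  rw [hmat]
  exact Matrix.posSemidef_self_mul_conjTranspose _

/-- `Σ_ab G_ab F_ab ≥ 0` for `G, F ⪰ 0` (Schur pairing). [folklore] -/
private theorem sum_sum_mul_nonneg_of_posSemidef {κ : Type*} [Fintype κ] {G F : Matrix κ κ ℂ}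
    (hG : G.PosSemidef) (hF : F.PosSemidef) : 0 ≤ ∑ a, ∑ b, G a b * F a b := by
  classical
  obtain ⟨B, hB⟩ := CStarAlgebra.nonneg_iff_eq_star_mul_self.mp hG.nonneg
  have hprod : ∀ a b : κ, G a b = ∑ k, star (B k a) * B k b := by
    intro a b
    rw [hB, Matrix.star_eq_conjTranspose, Matrix.mul_apply]
    exact Finset.sum_congr rfl fun k _ => by rw [conjTranspose_apply]
  have key : ∑ a, ∑ b, G a b * F a b = ∑ k, star (B k) ⬝ᵥ (F *ᵥ B k) := by
    simp only [dotProduct, mulVec, Pi.star_apply, Finset.mul_sum, hprod, Finset.sum_mul]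
    calc ∑ a, ∑ b, ∑ k, star (B k a) * B k b * F a b
        = ∑ a, ∑ k, ∑ b, star (B k a) * B k b * F a b :=
          Finset.sum_congr rfl fun a _ => Finset.sum_comm
      _ = ∑ k, ∑ a, ∑ b, star (B k a) * B k b * F a b := Finset.sum_comm
      _ = ∑ k, ∑ a, ∑ b, star (B k a) * (F a b * B k b) :=
          Finset.sum_congr rfl fun k _ => Finset.sum_congr rfl fun a _ =>
            Finset.sum_congr rfl fun b _ => by ring
  rw [key]
  exact Finset.sum_nonneg fun k _ => hF.dotProduct_mulVec_nonneg _

end Gram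

/-! ### The ground state at half filling is `Φ` of a positive definite matrix -/

section GroundState

variable {Λ : Type*} [LinearOrder Λ] [Fintype Λ]

omit [LinearOrder Λ] in
/-- `ext_n W ⪰ 0` for `W ⪰ 0`. [folklore] -/
private theorem posSemidef_extMatrix (n : ℕ) {W : Matrix (Config Λ n) (Config Λ n) ℂ} (hW : W.PosSemidef) :
    (extMatrix n W).PosSemidef := by
  refine Matrix.PosSemidef.of_dotProduct_mulVec_nonneg ?_ fun v => ?_
  · ext a b
    rw [conjTranspose_apply]
    by_cases h : b.card = n ∧ a.card = n
    · have h1 := extMatrix_apply_coe n W ⟨b, h.1⟩ ⟨a, h.2⟩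
      have h2 := extMatrix_apply_coe n W ⟨a, h.2⟩ ⟨b, h.1⟩
      simp only at h1 h2
      rw [h1, h2]
      exact hW.1.apply _ _
    · rw [extMatrix_apply_of_not n W h, extMatrix_apply_of_not n W (fun h' => h ⟨h'.2, h'.1⟩),
        star_zero]
  · have h : star v ⬝ᵥ extMatrix n W *ᵥ v =
        star (fun α : Config Λ n => v α.1) ⬝ᵥ W *ᵥ fun α => v α.1 := by
      simp only [dotProduct, mulVec, Pi.star_apply]
      rw [← sum_config_eq_sum n (fun a => star (v a) * ∑ b, extMatrix n W a b * v b)]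
      · refine Finset.sum_congr rfl fun α _ => ?_
        congr 1
        rw [← sum_config_eq_sum n (fun b => extMatrix n W α.1 b * v b)]
        · exact Finset.sum_congr rfl fun β _ => by rw [extMatrix_apply_coe]
        · intro b hb; rw [extMatrix_apply_of_not n W (fun h => hb h.2), zero_mul]
      · intro a ha
        rw [Finset.sum_eq_zero (fun b _ => ?_), mul_zero]
        rw [extMatrix_apply_of_not n W (fun h => ha h.1), zero_mul]
    rw [h]; exact hW.dotProduct_mulVec_nonneg _

/-- `Φ(W)` is a `|Λ|`-particle vector when `|Λ| = 2n`. [folklore] -/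
private theorem isNParticle_toFockN (A : Finset Λ) {n : ℕ} (hΛ : Fintype.card Λ = 2 * n)
    (W : Matrix (Config Λ n) (Config Λ n) ℂ) : IsNParticle (Fintype.card Λ) (toFockN A n W) := by
  intro s hs
  by_contra h
  obtain ⟨h1, h2⟩ := toFockN_apply_ne_zero A n W h
  apply hs
  rw [Finset.card_compl, hΛ] at h2
  have hle : (downPart s).card ≤ Fintype.card Λ := Finset.card_le_univ _
  rw [← pairSet_upPart_downPart s, card_pairSet, h1, hΛ]
  omega

variable {G : SimpleGraph Λ} [DecidableRel G.Adj]

/-- **Lieb's structure theorem for the half-filled ground state.** On a connected bipartite graph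
with `|A| = |B|`, `t ≠ 0`, `U > 0`, every half-filled ground state is a multiple of `Φ(W₀)` with
`W₀` positive definite (Lieb's `W₀ = |R|` argument plus uniqueness). [cite: LiebPRL1989, proof of Theorem 2] -/
theorem exists_posDef_coefficient_of_groundState (hG : G.Connected) (A : Finset Λ)
    (hA : ∀ x y : Λ, G.Adj x y → (x ∈ A ↔ y ∉ A)) (hcard : Aᶜ.card = A.card)
    {t U : ℝ} (ht : t ≠ 0) (hU : 0 < U) {ψ : Fock (Orb Λ)}
    (hN : IsNParticle (Fintype.card Λ) ψ)
    (hHψ : hamiltonian G t U *ᵥ ψ = ((groundEnergyAt G t U (Fintype.card Λ) : ℝ) : ℂ) • ψ) :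
    ∃ W₀ : Matrix (Config Λ A.card) (Config Λ A.card) ℂ, W₀.PosDef ∧
      ∃ c : ℂ, ψ = c • toFockN A A.card W₀ := by
  classical
  obtain ⟨ψ₁, hψ₁K, hψ₁1, hHψ₁, -, huniq₁, -⟩ :=
    LiebHalfFilled.exists_unit_groundState hG A hA hcard ht hU
  set n := A.card with hn
  have hΛ : Fintype.card Λ = 2 * n := by have := Finset.card_add_card_compl A; omega
  have hAn : A.card = n := hn.symm
  haveI : Nonempty (Config Λ n) := ⟨⟨A, hAn⟩⟩
  obtain ⟨W₀, hW₀pd, hW₀gs, huniq⟩ := exists_posDef_groundState G hG ht hU n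
  have hT : (liebK G t n).IsHermitian ∧ (liebK G t n).IsSymm :=
    ⟨LiebThm1.liebK_conjTranspose t n, LiebThm1.liebK_transpose G t n⟩
  set H := hamiltonian G t U with hH
  set E₀ : ℝ := groundEnergyAt G t U (Fintype.card Λ) with hE₀
  set LM := Literature.MathematicalPhysics.QuantumLattice.SpinReflection.liebMatrix
    (liebK G t n) (occInd n) (-U) with hLM
  set e := LM.groundEnergy with he
  have hΦH : ∀ W, H *ᵥ toFockN A n W =
      toFockN A n (Literature.MathematicalPhysics.QuantumLattice.liebOp (liebK G t n)
        (fun x => Literature.MathematicalPhysics.QuantumLattice.SpinReflection.rdiag (occInd n x))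
        (-U) W) + ((U : ℂ) * n) • toFockN A n W := hamiltonian_mulVec_toFockN G A hA t U n
  -- `ψ₁ = Φ(W₁)`
  set W₁ := resMatrix n (ofFock A ψ₁) with hW₁
  have hψ₁W : toFockN A n W₁ = ψ₁ := by
    obtain ⟨hψ₁N, hψ₁Z⟩ := (mem_szSector_iff _ _ _).1 hψ₁K
    apply toFockN_resMatrix_ofFock
    intro s hs
    have hcard' : s.card = Fintype.card Λ := by by_contra h; exact hs (hψ₁N s h)
    have hz := congrFun hψ₁Z s
    rw [LiebThm1.spinZ_mulVec_apply, Pi.smul_apply, smul_eq_mul, Complex.ofReal_zero, zero_mul,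
      mul_eq_zero, mul_eq_zero] at hz
    rcases hz with (hz | hz) | hz
    · norm_num at hz
    · rw [sub_eq_zero] at hz
      have hz' : (upPart s).card = (downPart s).card := by exact_mod_cast hz
      rw [← pairSet_upPart_downPart s, card_pairSet, hΛ] at hcard'
      refine ⟨by omega, ?_⟩
      rw [Finset.card_compl, hΛ]
      omega
    · exact absurd hz hs
  -- the Lieb-matrix eigenvalue equation of `W₁`
  have heig : LM *ᵥ vec W₁ = ((E₀ - U * n : ℝ) : ℂ) • vec W₁ := by
    have h1 := hHψ₁
    rw [← hψ₁W, hΦH] at h1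
    have h2 : toFockN A n (Literature.MathematicalPhysics.QuantumLattice.liebOp (liebK G t n)
        (fun x => Literature.MathematicalPhysics.QuantumLattice.SpinReflection.rdiag (occInd n x))
        (-U) W₁) = toFockN A n (((E₀ - U * n : ℝ) : ℂ) • W₁) := by
      rw [toFockN_smul]
      have hc : ((E₀ - U * n : ℝ) : ℂ) = (E₀ : ℂ) - (U : ℂ) * n := by push_cast; ring
      rw [hc, sub_smul]
      exact eq_sub_of_add_eq h1
    have h3 := toFockN_injective A n h2
    rw [hLM, Literature.MathematicalPhysics.QuantumLattice.SpinReflection.liebMatrix_mulVec_vec hT.2,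
      h3, vec_smul]
  -- the two ground energies agree: `E₀ - U n = e`
  have hW₁ne : vec W₁ ≠ 0 := by
    intro h
    rw [← vec_zero, vec_inj] at h
    have h0 : ψ₁ = 0 := by rw [← hψ₁W, h, toFockN_zero]
    rw [h0, dotProduct_zero] at hψ₁1
    exact zero_ne_one hψ₁1
  have hge : e ≤ E₀ - U * n := by
    obtain ⟨c, -, hc1⟩ := Literature.MathematicalPhysics.QuantumLattice.exists_smul_unit hW₁ne
    have h := Matrix.groundEnergy_le_rayleigh_holds
      (Literature.MathematicalPhysics.QuantumLattice.SpinReflection.liebMatrix_isHermitian hT.1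
        (occInd n) (-U)) (c • vec W₁) hc1
    rw [mulVec_smul, ← hLM, heig, smul_comm, dotProduct_smul, hc1, smul_eq_mul, mul_one,
      Complex.ofReal_re] at h
    exact h
  have hW₀ne : W₀ ≠ 0 := by
    intro h
    have := hW₀pd.diag_pos (i := ⟨A, hAn⟩)
    rw [h] at this
    exact lt_irrefl _ this
  have hψ₀ne : toFockN A n W₀ ≠ 0 := fun h =>
    hW₀ne (toFockN_injective A n (by rw [h, toFockN_zero]))
  have hliebOpW₀ := (Literature.MathematicalPhysics.QuantumLattice.SpinReflection.mem_groundSpace_iff_liebOp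
    hT.2 (occInd n) (-U) W₀).1 hW₀gs
  have hHψ₀ : H *ᵥ toFockN A n W₀ = ((e + U * n : ℝ) : ℂ) • toFockN A n W₀ := by
    rw [hΦH, hliebOpW₀, toFockN_smul, ← add_smul]
    push_cast; rfl
  have hle : E₀ ≤ e + U * n := by
    obtain ⟨c, -, hc1⟩ := Literature.MathematicalPhysics.QuantumLattice.exists_smul_unit hψ₀ne
    have hcN : IsNParticle (Fintype.card Λ) (c • toFockN A n W₀) := by
      intro s hs; rw [Pi.smul_apply, isNParticle_toFockN A hΛ W₀ s hs, smul_zero]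
    have h := LiebThm1.groundEnergy_le_re_expect H hcN hc1
    rw [expect, mulVec_smul, hHψ₀, smul_comm, dotProduct_smul, hc1, smul_eq_mul, mul_one,
      Complex.ofReal_re] at h
    exact h
  have hE : ((E₀ - U * n : ℝ) : ℂ) = (e : ℂ) := by
    rw [show E₀ - U * n = e from le_antisymm (by linarith) hge]
  -- uniqueness on both sides
  rw [hE] at heig
  have hgs : vec W₁ ∈ LM.groundSpace := (Matrix.mem_groundSpace_iff _ _).2 heig
  obtain ⟨c₁, hc₁⟩ := huniq _ hgs
  have hW₁c : W₁ = c₁ • W₀ := vec_inj.1 (by rw [hc₁, vec_smul])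
  have hψ₁eq : ψ₁ = c₁ • toFockN A n W₀ := by rw [← toFockN_smul, ← hW₁c, hψ₁W]
  have key := huniq₁ ψ hN hHψ
  set d := star ψ₁ ⬝ᵥ ψ with hd
  refine ⟨W₀, hW₀pd, d * c₁, ?_⟩
  rw [key, hψ₁eq, smul_smul]

/-! ### Lieb's Gram block -/

/-- **Spin-reflection positivity of the half-filled ground state (Gram form).** For every
half-filled ground state `ψ` (connected bipartite `G`, `|A| = |B|`, `t ≠ 0`, `U > 0`), every sign
function with `ε_x ε_y = memSign A x · memSign A y` (i.e. `ε = ±` the sublattice sign) and every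
finite family of words `w`, the matrix `[⟨ψ, u(w a) d̃(w b) ψ⟩]_{ab}` is positive semidefinite.
[cite: LiebPRL1989, proof of Theorem 2] -/
theorem liebGram_posSemidef (hG : G.Connected) (A : Finset Λ)
    (hA : ∀ x y : Λ, G.Adj x y → (x ∈ A ↔ y ∉ A)) (hcard : Aᶜ.card = A.card)
    {t U : ℝ} (ht : t ≠ 0) (hU : 0 < U)
    {ε : Λ → ℂ} (hε : ∀ x y, ε x * ε y = memSign A x * memSign A y)
    {ψ : Fock (Orb Λ)} (hN : IsNParticle (Fintype.card Λ) ψ)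
    (hHψ : hamiltonian G t U *ᵥ ψ = ((groundEnergyAt G t U (Fintype.card Λ) : ℝ) : ℂ) • ψ)
    {κ : Type*} [Fintype κ] (w : κ → List (Λ × Λ)) :
    (Matrix.of fun a b : κ =>
      star ψ ⬝ᵥ ((upWord (w a) * shibaDownWord ε (w b)) *ᵥ ψ)).PosSemidef := by
  classical
  obtain ⟨W₀, hW₀pd, c, rfl⟩ := exists_posDef_coefficient_of_groundState hG A hA hcard ht hU hN hHψ
  have hMpsd : (extMatrix A.card W₀).PosSemidef := posSemidef_extMatrix A.card hW₀pd.posSemidef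
  have hF := posSemidef_hsInner_sandwich hMpsd (fun a => wordMatrix (w a))
    (fun b => wordMatrix_conjTranspose (w b))
  have hentry : ∀ a b, star (c • toFockN A A.card W₀) ⬝ᵥ
      ((upWord (w a) * shibaDownWord ε (w b)) *ᵥ (c • toFockN A A.card W₀)) =
        star c * hsInner (extMatrix A.card W₀)
          (wordMatrix (w a) * extMatrix A.card W₀ * (wordMatrix (w b))ᵀ) * c := by
    intro a b
    rw [mulVec_smul, star_smul, smul_dotProduct, dotProduct_smul, toFockN,
      star_toFock_dotProduct_upWord_mul_shibaDownWord_mulVec A hε, smul_eq_mul, smul_eq_mul]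
    ring
  have hmat : (Matrix.of fun a b : κ => star (c • toFockN A A.card W₀) ⬝ᵥ
      ((upWord (w a) * shibaDownWord ε (w b)) *ᵥ (c • toFockN A A.card W₀))) =
      (diagonal fun _ : κ => c)ᴴ *
        (Matrix.of fun a b : κ => hsInner (extMatrix A.card W₀)
          (wordMatrix (w a) * extMatrix A.card W₀ * (wordMatrix (w b))ᵀ)) *
        diagonal fun _ : κ => c := by
    ext a b
    rw [diagonal_conjTranspose, Matrix.mul_diagonal, Matrix.diagonal_mul, Matrix.of_apply,
      Matrix.of_apply, hentry, Pi.star_apply]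
  rw [hmat]
  exact hF.conjTranspose_mul_mul_same _

/-- The spin flip maps down words to up words. [folklore] -/
private theorem relabel_spinSwap_downWord (l : List (Λ × Λ)) :
    relabel (Orb.spinSwap : Orb Λ ≃ Orb Λ) (downWord l) = upWord l := by
  induction l with
  | nil => simp [downWord, upWord]
  | cons p l ih =>
    have h1 : downWord (p :: l) = (creation (orb p.1 1) * annihilation (orb p.2 1)) * downWord l := by
      rw [downWord, List.map_cons, List.prod_cons]; rfl
    have h2 : upWord (p :: l) = (creation (orb p.1 0) * annihilation (orb p.2 0)) * upWord l := by
      rw [upWord, List.map_cons, List.prod_cons]; rfl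
    rw [h1, h2, map_mul, map_mul, ih, relabel_creation, relabel_annihilation, Orb.spinSwap_orb,
      Orb.spinSwap_orb, Equiv.swap_apply_right]

/-- The spin flip maps Shiba up words to Shiba down words. [folklore] -/
private theorem relabel_spinSwap_shibaUpWord (ε : Λ → ℂ) (l : List (Λ × Λ)) :
    relabel (Orb.spinSwap : Orb Λ ≃ Orb Λ) (shibaUpWord ε l) = shibaDownWord ε l := by
  induction l with
  | nil => simp [shibaUpWord, shibaDownWord]
  | cons p l ih =>
    have h1 : shibaUpWord ε (p :: l) =
        ((ε p.1 * ε p.2) • (annihilation (orb p.1 0) * creation (orb p.2 0))) * shibaUpWord ε l := by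
      rw [shibaUpWord, List.map_cons, List.prod_cons]; rfl
    have h2 : shibaDownWord ε (p :: l) =
        ((ε p.1 * ε p.2) • (annihilation (orb p.1 1) * creation (orb p.2 1))) * shibaDownWord ε l := by
      rw [shibaDownWord, List.map_cons, List.prod_cons]; rfl
    rw [h1, h2, map_mul, map_smul, map_mul, ih, relabel_creation, relabel_annihilation,
      Orb.spinSwap_orb, Orb.spinSwap_orb, Equiv.swap_apply_left]

/-- **The flipped Gram block** `[⟨ψ, d(w a) ũ(w b) ψ⟩]_{ab} ⪰ 0` (spin-flip symmetry of the
half-filled ground state). [cite: LiebPRL1989, proof of Theorem 2] -/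
theorem liebGram_posSemidef_flip (hG : G.Connected) (A : Finset Λ)
    (hA : ∀ x y : Λ, G.Adj x y → (x ∈ A ↔ y ∉ A)) (hcard : Aᶜ.card = A.card)
    {t U : ℝ} (ht : t ≠ 0) (hU : 0 < U)
    {ε : Λ → ℂ} (hε : ∀ x y, ε x * ε y = memSign A x * memSign A y)
    {ψ : Fock (Orb Λ)} (hN : IsNParticle (Fintype.card Λ) ψ)
    (hHψ : hamiltonian G t U *ᵥ ψ = ((groundEnergyAt G t U (Fintype.card Λ) : ℝ) : ℂ) • ψ)
    {κ : Type*} [Fintype κ] (w : κ → List (Λ × Λ)) :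
    (Matrix.of fun a b : κ =>
      star ψ ⬝ᵥ ((downWord (w a) * shibaUpWord ε (w b)) *ᵥ ψ)).PosSemidef := by
  classical
  have hφN : IsNParticle (Fintype.card Λ) (relabelVec (Orb.spinSwap : Orb Λ ≃ Orb Λ) ψ) :=
    isNParticle_relabelVec _ hN
  have hHφ : hamiltonian G t U *ᵥ relabelVec (Orb.spinSwap : Orb Λ ≃ Orb Λ) ψ =
      ((groundEnergyAt G t U (Fintype.card Λ) : ℝ) : ℂ) •
        relabelVec (Orb.spinSwap : Orb Λ ≃ Orb Λ) ψ := by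
    rw [← relabel_spinSwap_hamiltonian G t U, relabel_mulVec_relabelVec, hHψ]
    funext s; simp only [relabelVec, Pi.smul_apply, smul_eq_mul]; ring
  have h := liebGram_posSemidef hG A hA hcard ht hU hε hφN hHφ w
  have hmat : (Matrix.of fun a b : κ => star ψ ⬝ᵥ ((downWord (w a) * shibaUpWord ε (w b)) *ᵥ ψ)) =
      Matrix.of fun a b : κ => star (relabelVec (Orb.spinSwap : Orb Λ ≃ Orb Λ) ψ) ⬝ᵥ
        ((upWord (w a) * shibaDownWord ε (w b)) *ᵥ relabelVec (Orb.spinSwap : Orb Λ ≃ Orb Λ) ψ) := by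
    ext a b
    rw [Matrix.of_apply, Matrix.of_apply, ← relabel_spinSwap_downWord, ← relabel_spinSwap_shibaUpWord,
      ← map_mul, relabel_mulVec_relabelVec, star_relabelVec_dotProduct]
  rw [hmat]; exact h

/-! ### The Lieb forms (block kinds `liebgram`, `liebgram_flip`) -/

/-- The Lieb form `Σ_ab G_ab u(w a) d̃(w b)` paired with a dual matrix `G`. [cite: KullEtAl2024, §5.3] -/
def liebForm (ε : Λ → ℂ) {κ : Type*} [Fintype κ] (Gm : Matrix κ κ ℂ) (w : κ → List (Λ × Λ)) :
    Matrix (Finset (Orb Λ)) (Finset (Orb Λ)) ℂ :=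
  ∑ a, ∑ b, Gm a b • (upWord (w a) * shibaDownWord ε (w b))

/-- The flipped Lieb form `Σ_ab G_ab d(w a) ũ(w b)`. [cite: KullEtAl2024, §5.3] -/
def liebFormFlip (ε : Λ → ℂ) {κ : Type*} [Fintype κ] (Gm : Matrix κ κ ℂ) (w : κ → List (Λ × Λ)) :
    Matrix (Finset (Orb Λ)) (Finset (Orb Λ)) ℂ :=
  ∑ a, ∑ b, Gm a b • (downWord (w a) * shibaUpWord ε (w b))

/-- **The Lieb form is nonnegative in every half-filled ground state** for `G ⪰ 0`.
[cite: LiebPRL1989, proof of Theorem 2] [cite: KullEtAl2024, §5.3] -/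
theorem liebForm_expect_nonneg (hG : G.Connected) (A : Finset Λ)
    (hA : ∀ x y : Λ, G.Adj x y → (x ∈ A ↔ y ∉ A)) (hcard : Aᶜ.card = A.card)
    {t U : ℝ} (ht : t ≠ 0) (hU : 0 < U)
    {ε : Λ → ℂ} (hε : ∀ x y, ε x * ε y = memSign A x * memSign A y)
    {ψ : Fock (Orb Λ)} (hN : IsNParticle (Fintype.card Λ) ψ)
    (hHψ : hamiltonian G t U *ᵥ ψ = ((groundEnergyAt G t U (Fintype.card Λ) : ℝ) : ℂ) • ψ)
    {κ : Type*} [Fintype κ] {Gm : Matrix κ κ ℂ} (hGm : Gm.PosSemidef) (w : κ → List (Λ × Λ)) :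
    0 ≤ star ψ ⬝ᵥ liebForm ε Gm w *ᵥ ψ := by
  classical
  have h : star ψ ⬝ᵥ liebForm ε Gm w *ᵥ ψ =
      ∑ a, ∑ b, Gm a b * (Matrix.of fun a b : κ =>
        star ψ ⬝ᵥ ((upWord (w a) * shibaDownWord ε (w b)) *ᵥ ψ)) a b := by
    simp only [liebForm, Matrix.sum_mulVec, dotProduct_sum, Matrix.smul_mulVec, dotProduct_smul,
      smul_eq_mul, Matrix.of_apply]
  rw [h]
  exact sum_sum_mul_nonneg_of_posSemidef hGm (liebGram_posSemidef hG A hA hcard ht hU hε hN hHψ w)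

/-- **The flipped Lieb form is nonnegative in every half-filled ground state** for `G ⪰ 0`.
[cite: LiebPRL1989, proof of Theorem 2] [cite: KullEtAl2024, §5.3] -/
theorem liebFormFlip_expect_nonneg (hG : G.Connected) (A : Finset Λ)
    (hA : ∀ x y : Λ, G.Adj x y → (x ∈ A ↔ y ∉ A)) (hcard : Aᶜ.card = A.card)
    {t U : ℝ} (ht : t ≠ 0) (hU : 0 < U)
    {ε : Λ → ℂ} (hε : ∀ x y, ε x * ε y = memSign A x * memSign A y)
    {ψ : Fock (Orb Λ)} (hN : IsNParticle (Fintype.card Λ) ψ)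
    (hHψ : hamiltonian G t U *ᵥ ψ = ((groundEnergyAt G t U (Fintype.card Λ) : ℝ) : ℂ) • ψ)
    {κ : Type*} [Fintype κ] {Gm : Matrix κ κ ℂ} (hGm : Gm.PosSemidef) (w : κ → List (Λ × Λ)) :
    0 ≤ star ψ ⬝ᵥ liebFormFlip ε Gm w *ᵥ ψ := by
  classical
  have h : star ψ ⬝ᵥ liebFormFlip ε Gm w *ᵥ ψ =
      ∑ a, ∑ b, Gm a b * (Matrix.of fun a b : κ =>
        star ψ ⬝ᵥ ((downWord (w a) * shibaUpWord ε (w b)) *ᵥ ψ)) a b := by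
    simp only [liebFormFlip, Matrix.sum_mulVec, dotProduct_sum, Matrix.smul_mulVec, dotProduct_smul,
      smul_eq_mul, Matrix.of_apply]
  rw [h]
  exact sum_sum_mul_nonneg_of_posSemidef hGm
    (liebGram_posSemidef_flip hG A hA hcard ht hU hε hN hHψ w)

end GroundState

end LiebTwo

/-! ### The even square torus at half filling: the Gram blocks in THE ground state -/

section Torus

open LiebTwo

variable {L : ℕ} [NeZero L]

/-- The sublattice sign `ε_x = (-1)^{x₁+x₂}` of the square torus as a complex number — the `ε`
of the Shiba words in the `liebgram` block. [cite: LiebPRL1989, Theorem 2] -/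
def torusSign (x : FermionTorus 2 L) : ℂ := ((torusStagger x : ℤ) : ℂ)

omit [NeZero L] in
/-- `ε_x ε_y = memSign A x · memSign A y` for the sublattice `A = {ε = +1}` (`ε = -memSign A`).
[folklore] -/
private theorem torusSign_mul_torusSign (x y : FermionTorus 2 L) :
    torusSign x * torusSign y =
      memSign (univ.filter fun z : FermionTorus 2 L => torusStagger z = 1) x *
        memSign (univ.filter fun z : FermionTorus 2 L => torusStagger z = 1) y := by
  have h : ∀ z : FermionTorus 2 L, torusSign z =
      -memSign (univ.filter fun z : FermionTorus 2 L => torusStagger z = 1) z := by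
    intro z
    simp only [torusSign, memSign, Finset.mem_filter, Finset.mem_univ, true_and]
    rcases Int.units_eq_one_or (torusStagger z) with hz | hz
    · rw [if_pos hz, hz, neg_neg]; simp
    · rw [if_neg (by rw [hz]; decide), hz]; simp
  rw [h, h, neg_mul_neg]

omit [NeZero L] in
/-- `|Λ| = L²` on the square torus. [folklore] -/
private theorem card_fermionTorus_two : Fintype.card (FermionTorus 2 L) = L ^ 2 := by
  simp only [FermionTorus, Fintype.card_lex, Fintype.card_fun, Fintype.card_fin]

/-- **Lieb's Gram block on the even square torus** (block kind `liebgram`): for every half-filled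
ground state `ψ` of `hubbardTorus 2 L t U` (`L` even, `t ≠ 0`, `U > 0`) and every finite family
of words, `[⟨ψ, u(w a) d̃(w b) ψ⟩]_{ab} ⪰ 0` with `d̃` the Shiba words of the sublattice sign
`torusSign`. [cite: LiebPRL1989, proof of Theorem 2] -/
theorem hubbardTorus_liebGram_posSemidef (hL : Even L) {t U : ℝ} (ht : t ≠ 0) (hU : 0 < U)
    {ψ : Fock (Orb (FermionTorus 2 L))} (hN : IsNParticle (L ^ 2) ψ)
    (hHψ : hubbardTorus 2 L t U *ᵥ ψ =
      ((groundEnergyAt (fermionTorusGraph 2 L) t U (L ^ 2) : ℝ) : ℂ) • ψ)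
    {κ : Type*} [Fintype κ] (w : κ → List (FermionTorus 2 L × FermionTorus 2 L)) :
    (Matrix.of fun a b : κ =>
      star ψ ⬝ᵥ ((upWord (w a) * shibaDownWord torusSign (w b)) *ᵥ ψ)).PosSemidef := by
  obtain ⟨hG, hA, h2, -⟩ := LiebHalfFilled.hubbardTorus_lieb_hypotheses (L := L) hL
  have hcard := LiebHalfFilled.compl_card_eq_card_of_two_mul h2
  rw [← card_fermionTorus_two] at hN hHψ
  exact liebGram_posSemidef hG _ hA hcard ht hU torusSign_mul_torusSign hN hHψ w

/-- **The flipped Gram block on the even square torus** (block kind `liebgram_flip`):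
`[⟨ψ, d(w a) ũ(w b) ψ⟩]_{ab} ⪰ 0`. [cite: LiebPRL1989, proof of Theorem 2] -/
theorem hubbardTorus_liebGram_posSemidef_flip (hL : Even L) {t U : ℝ} (ht : t ≠ 0) (hU : 0 < U)
    {ψ : Fock (Orb (FermionTorus 2 L))} (hN : IsNParticle (L ^ 2) ψ)
    (hHψ : hubbardTorus 2 L t U *ᵥ ψ =
      ((groundEnergyAt (fermionTorusGraph 2 L) t U (L ^ 2) : ℝ) : ℂ) • ψ)
    {κ : Type*} [Fintype κ] (w : κ → List (FermionTorus 2 L × FermionTorus 2 L)) :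
    (Matrix.of fun a b : κ =>
      star ψ ⬝ᵥ ((downWord (w a) * shibaUpWord torusSign (w b)) *ᵥ ψ)).PosSemidef := by
  obtain ⟨hG, hA, h2, -⟩ := LiebHalfFilled.hubbardTorus_lieb_hypotheses (L := L) hL
  have hcard := LiebHalfFilled.compl_card_eq_card_of_two_mul h2
  rw [← card_fermionTorus_two] at hN hHψ
  exact liebGram_posSemidef_flip hG _ hA hcard ht hU torusSign_mul_torusSign hN hHψ w

/-- The Lieb form paired with `G ⪰ 0` is nonnegative in every half-filled torus ground state.
[cite: LiebPRL1989, proof of Theorem 2] [cite: KullEtAl2024, §5.3] -/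
theorem hubbardTorus_liebForm_expect_nonneg (hL : Even L) {t U : ℝ} (ht : t ≠ 0) (hU : 0 < U)
    {ψ : Fock (Orb (FermionTorus 2 L))} (hN : IsNParticle (L ^ 2) ψ)
    (hHψ : hubbardTorus 2 L t U *ᵥ ψ =
      ((groundEnergyAt (fermionTorusGraph 2 L) t U (L ^ 2) : ℝ) : ℂ) • ψ)
    {κ : Type*} [Fintype κ] {Gm : Matrix κ κ ℂ} (hGm : Gm.PosSemidef)
    (w : κ → List (FermionTorus 2 L × FermionTorus 2 L)) :
    0 ≤ star ψ ⬝ᵥ liebForm torusSign Gm w *ᵥ ψ := by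
  obtain ⟨hG, hA, h2, -⟩ := LiebHalfFilled.hubbardTorus_lieb_hypotheses (L := L) hL
  have hcard := LiebHalfFilled.compl_card_eq_card_of_two_mul h2
  rw [← card_fermionTorus_two] at hN hHψ
  exact liebForm_expect_nonneg hG _ hA hcard ht hU torusSign_mul_torusSign hN hHψ hGm w

/-- The flipped Lieb form paired with `G ⪰ 0` is nonnegative in every half-filled torus ground
state. [cite: LiebPRL1989, proof of Theorem 2] [cite: KullEtAl2024, §5.3] -/
theorem hubbardTorus_liebFormFlip_expect_nonneg (hL : Even L) {t U : ℝ} (ht : t ≠ 0)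
    (hU : 0 < U) {ψ : Fock (Orb (FermionTorus 2 L))} (hN : IsNParticle (L ^ 2) ψ)
    (hHψ : hubbardTorus 2 L t U *ᵥ ψ =
      ((groundEnergyAt (fermionTorusGraph 2 L) t U (L ^ 2) : ℝ) : ℂ) • ψ)
    {κ : Type*} [Fintype κ] {Gm : Matrix κ κ ℂ} (hGm : Gm.PosSemidef)
    (w : κ → List (FermionTorus 2 L × FermionTorus 2 L)) :
    0 ≤ star ψ ⬝ᵥ liebFormFlip torusSign Gm w *ᵥ ψ := by
  obtain ⟨hG, hA, h2, -⟩ := LiebHalfFilled.hubbardTorus_lieb_hypotheses (L := L) hL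
  have hcard := LiebHalfFilled.compl_card_eq_card_of_two_mul h2
  rw [← card_fermionTorus_two] at hN hHψ
  exact liebFormFlip_expect_nonneg hG _ hA hcard ht hU torusSign_mul_torusSign hN hHψ hGm w

end Torus

end Literature.MathematicalPhysics.QuantumLattice
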